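import Literature.NumberTheory.Automorphic.IntegralWeightHeckeModuleGL2
import Literature.NumberTheory.Automorphic.CuspidalCohomologyGL
import Literature.NumberTheory.Automorphic.CompletedCohomology
import HarnessLib

/-!
# Coefficients at `p` versus coefficients at `∞`: the comparison on cohomology is Hecke-equivariant

Topic `NumberTheory/Automorphic`; namespace `Literature.NumberTheory.Automorphic.LevelAction`
(the grouping namespace of the "coefficients at `p`" model of `IntegralWeightHeckeModuleGL2`).
Theorems and two `def`s (an isomorphism of representations and the induced isomorphism on
cohomology); no named fact, no instance.

`IntegralWeightHeckeModuleGL2` constructs the "coefficients at `p`" model of the cohomology of an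
arithmetic quotient of level `U ≤ 𝒢` — the `Γ`-representation (left translation) on the sections
`M(U, τ) = {f : 𝒢 → V | τ(u) f(g u) = f(g)}` of a level `U ⊆ Δ` acting on the coefficients `V`
through `τ : Δ → End V` — and, when `τ` is the restriction of an action `σ` of ALL of `𝒢` on `V`,
the `Γ`-equivariant comparison isomorphism of coefficient modules
`sectionsEquivLevelFunctions : M(U, σ|_Δ) ≃ Fun(𝒢 ⧸ U, V)`, `f ↦ (gU ↦ σ(g) f(g))`
(`toLevelFunctions_leftTranslation`: left translation goes to the TWISTED action
`(γ F)(c) = σ(ιγ) F(ι(γ)⁻¹ c)`), leaving the passage to cohomology to "functoriality".  This file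
carries it out, landing in the tree's "coefficients at `∞`" model `TwistedQuotient.cohomology ι U ρ`
(`CuspidalCohomologyGL`; `ρ = σ ∘ ι`), the model of `ParallelWeight.cohomology` in
`BianchiOrdinaryClassicality`:

* `sectionsEquivLevelFunctions_rep`, `repIsoTwistedRep` — `M(U, σ|_Δ) ≅ Fun(𝒢 ⧸ U, V)` as
  `Γ`-representations, the target being `TwistedQuotient.coeffRep ι U (σ ∘ ι)`;
* `toLevelFunctions_heckeOp` — **the Hecke operators correspond ON THE NOSE**: for every `α ∈ Δ`,
  `Φ ([UαU] f) = T_α (Φ f)`, where `[UαU] f = ∑_{d ∈ UαU/U} τ(d̃) f(· d̃)` is the Hecke operator of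
  the level-action model (the coefficients are moved by `τ(d̃)`) and `T_α F = ∑_{d} F(· d)` is the
  plain double-coset operator `ArithmeticQuotient.heckeFun` of the twisted model — because
  `σ(g) τ(d̃) = σ(g d̃)`.  In particular the OPTIMALLY INTEGRAL operator `U_v = [U t_v U]` of the
  coefficients-at-`p` model (Hida's `T(x)`, integral on `L(n, v; 𝒪)`) is the plain `[U t_v U]` of the
  rational coefficients-at-`∞` model, and the diamond operators and the `T_w`, `w ∤ p`, agree;
  as morphisms of representations `heckeRepHom_comp_repIsoTwistedRep_hom`;
* `twistedCohomologyIso` — **`H^i(U, σ|_Δ) ≅ H^i(X_U, Ṽ)`** (`LevelAction.cohomology ≅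
  TwistedQuotient.cohomology ι U (σ ∘ ι)`), with `heckeCohomology_comp_twistedCohomologyIso_hom`:
  `Φ_* ∘ [UαU] = T_α ∘ Φ_*` (`T_α = TwistedQuotient.heckeEnd`), its pointwise form, and the transport
  of eigenvectors (`twistedCohomologyIso_eigenvector`) and of non-vanishing.

This is the comparison "the 'at `p`' and 'at `∞`' models are isomorphic `Γ`-equivariantly, hence so
are their group cohomologies" of [Hida1994AIF, §1] (the map `(g, P) ↦ (g, g_p P)` between
`L(n, v; A)`-valued functions), used in [KhareThorne2017, §6.4–6.5] to pass from the ordinary part of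
`H^•(X_{U(c,c)}, M_𝛌)` (coefficients at `p`, Prop. 6.13) to classical weight-`𝛌` cohomology.

## References

* H. Hida, *p-adic ordinary Hecke algebras for GL(2)*, Ann. Inst. Fourier 44 (1994), §1
  (pp. 1292–1294) (held; read 2026-08-16). [Hida1994AIF]
* C. Khare, J. A. Thorne, *Potential automorphy and the Leopoldt conjecture*, Amer. J. Math. 139
  (2017), §6.4 Prop. 6.13, Cor. 6.15 (arXiv:1409.7007, held). [KhareThorne2017]
-/

noncomputable section

open CategoryTheory

universe u

namespace Literature.NumberTheory.Automorphic.LevelAction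

variable {R : Type u} [CommRing R] {Γ 𝒢 : Type u} [Group Γ] [Group 𝒢] (ι : Γ →* 𝒢)
  (Δ : Submonoid 𝒢) {V : Type u} [AddCommGroup V] [Module R V] (τ : Δ →* Module.End R V)
  (U : Subgroup 𝒢) (σ : Representation R 𝒢 V)

/-! ### `M(U, σ|_Δ) ≅ Fun(𝒢 ⧸ U, V)` as `Γ`-representations -/

variable {Δ τ U σ}

/-- **`Φ` is `Γ`-equivariant** from the left-translation representation `rep` on `M(U, σ|_Δ)` to the
twisted coefficient representation `TwistedQuotient.coeffRepresentation ι U (σ ∘ ι)` on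
`Fun(𝒢 ⧸ U, V)` (restatement of `toLevelFunctions_leftTranslation`). [cite: Hida1994AIF, §1] -/
theorem sectionsEquivLevelFunctions_rep (hστ : ∀ δ : Δ, τ δ = σ δ) (hU : U.toSubmonoid ≤ Δ)
    (γ : Γ) (f : sections Δ τ U) :
    sectionsEquivLevelFunctions τ U σ hστ hU (rep ι Δ τ U γ f) =
      TwistedQuotient.coeffRepresentation ι U (σ.comp ι) γ
        (sectionsEquivLevelFunctions τ U σ hστ hU f) := by
  funext c
  rw [sectionsEquivLevelFunctions_apply, sectionsEquivLevelFunctions_apply, coe_rep_apply,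
    toLevelFunctions_leftTranslation ι hστ hU f.2 γ c, TwistedQuotient.coeffRepresentation_apply,
    MonoidHom.comp_apply]

variable (Δ τ U σ) in
/-- **`M(U, σ|_Δ) ≅ Fun(𝒢 ⧸ U, V)` as `Γ`-representations** ("coefficients at `p`" ≅ "coefficients at
`∞`" when all of `𝒢` acts on the coefficients), the target being the coefficient object
`TwistedQuotient.coeffRep ι U (σ ∘ ι)` of the tree's twisted arithmetic-quotient model.
[cite: Hida1994AIF, §1] -/
def repIsoTwistedRep (hστ : ∀ δ : Δ, τ δ = σ δ) (hU : U.toSubmonoid ≤ Δ) :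
    Rep.of (rep ι Δ τ U) ≅ TwistedQuotient.coeffRep ι U (σ.comp ι) :=
  Rep.mkIso (Representation.Equiv.mk (sectionsEquivLevelFunctions τ U σ hστ hU) fun γ =>
    LinearMap.ext fun f => sectionsEquivLevelFunctions_rep ι hστ hU γ f)

/-- Unfolding lemma for `repIsoTwistedRep`. [folklore] -/
@[simp]
theorem repIsoTwistedRep_hom_apply (hστ : ∀ δ : Δ, τ δ = σ δ) (hU : U.toSubmonoid ≤ Δ)
    (f : sections Δ τ U) :
    (repIsoTwistedRep ι Δ τ U σ hστ hU).hom f = sectionsEquivLevelFunctions τ U σ hστ hU f :=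
  rfl

/-! ### Hecke operators correspond on the nose -/

open scoped Classical in
/-- **`Φ ([UαU] f) = T_α (Φ f)`** for `α ∈ Δ ⊇ U` and `f ∈ M(U, σ|_Δ)`: the Hecke operator
`[UαU] f = ∑_{d ∈ UαU/U} σ(d̃) f(· d̃)` of the level-action model goes to the plain double-coset
operator `T_α F (gU) = ∑_{d} F(g • d)` (`ArithmeticQuotient.heckeFun`) of the twisted model, since
`σ(g) σ(d̃) f(g d̃) = σ(g d̃) f(g d̃) = Φ f (g d̃ U)`. [cite: Hida1994AIF, §1] -/
theorem toLevelFunctions_heckeOp (hστ : ∀ δ : Δ, τ δ = σ δ) (hU : U.toSubmonoid ≤ Δ) {α : 𝒢}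
    (hα : α ∈ Δ) {f : 𝒢 → V} (hf : f ∈ sections Δ τ U) :
    toLevelFunctions U σ (heckeOp Δ (fnAction Δ τ) U α f) =
      ArithmeticQuotient.heckeFun R U α V (toLevelFunctions U σ f) := by
  funext c
  induction c using QuotientGroup.induction_on with
  | H g =>
    rw [toLevelFunctions_apply_mk hστ hU (heckeOp_apply_mem hU hα hf) g]
    by_cases h : (ArithmeticQuotient.doubleCosetQuot U α).Finite
    swap
    · rw [heckeOp_eq_zero_of_infinite h, ArithmeticQuotient.heckeFun_apply, dif_neg h,
        LinearMap.zero_apply, Pi.zero_apply, map_zero]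
    rw [heckeOp_eq_sum h, ArithmeticQuotient.heckeFun_apply_coe R U V α _ g h, LinearMap.sum_apply,
      Finset.sum_apply, map_sum]
    refine Finset.sum_congr rfl fun d hd => ?_
    rw [Set.Finite.mem_toFinset] at hd
    have hdΔ : d.out ∈ Δ := out_mem_of_mem_doubleCosetQuot hU hα hd
    have hgd : (g : 𝒢) • d = ((g * d.out : 𝒢) : 𝒢 ⧸ U) := by
      conv_lhs => rw [← QuotientGroup.out_eq' d]
      rfl
    rw [act_of_mem hdΔ, fnAction_apply, hστ ⟨d.out, hdΔ⟩, hgd, toLevelFunctions_apply_mk hστ hU hf,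
      map_mul, Module.End.mul_apply]

/-- The same on the bundled sections: `Φ ∘ [UαU]|_{M(U,τ)} = T_α ∘ Φ`. [folklore] -/
theorem sectionsEquivLevelFunctions_heckeOpInv (hστ : ∀ δ : Δ, τ δ = σ δ)
    (hU : U.toSubmonoid ≤ Δ) {α : 𝒢} (hα : α ∈ Δ) (f : sections Δ τ U) :
    sectionsEquivLevelFunctions τ U σ hστ hU (heckeOpInv hU hα f) =
      ArithmeticQuotient.heckeFun R U α V (sectionsEquivLevelFunctions τ U σ hστ hU f) := by
  rw [sectionsEquivLevelFunctions_apply, sectionsEquivLevelFunctions_apply, coe_heckeOpInv_apply]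
  exact toLevelFunctions_heckeOp hστ hU hα f.2

/-- **As morphisms of representations: `[UαU] ≫ Φ = Φ ≫ T_α`** (`T_α = TwistedQuotient.heckeRepHom`).
[cite: Hida1994AIF, §1] -/
theorem heckeRepHom_comp_repIsoTwistedRep_hom (hστ : ∀ δ : Δ, τ δ = σ δ)
    (hU : U.toSubmonoid ≤ Δ) {α : 𝒢} (hα : α ∈ Δ) :
    heckeRepHom ι Δ τ U hU hα ≫ (repIsoTwistedRep ι Δ τ U σ hστ hU).hom =
      (repIsoTwistedRep ι Δ τ U σ hστ hU).hom ≫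
        TwistedQuotient.heckeRepHom ι U (σ.comp ι) α :=
  Rep.hom_ext (Representation.IntertwiningMap.ext (LinearMap.ext fun f => by
    change sectionsEquivLevelFunctions τ U σ hστ hU (heckeOpInv hU hα f) =
      ArithmeticQuotient.heckeFun R U α V (sectionsEquivLevelFunctions τ U σ hστ hU f)
    exact sectionsEquivLevelFunctions_heckeOpInv hστ hU hα f))

/-! ### Cohomology -/

variable (Δ τ U σ) in
/-- **`H^i(U, σ|_Δ) ≅ H^i(X_U, Ṽ)`**: the cohomology of the coefficients-at-`p` model is the
cohomology of the arithmetic quotient of level `U` with coefficients in the local system of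
`ρ = σ ∘ ι` (`TwistedQuotient.cohomology`, the model of `ParallelWeight.cohomology`), by
functoriality of `groupCohomology` along `repIsoTwistedRep`. [cite: Hida1994AIF, §1] -/
def twistedCohomologyIso (hστ : ∀ δ : Δ, τ δ = σ δ) (hU : U.toSubmonoid ≤ Δ) (i : ℕ) :
    cohomology ι Δ τ U i ≅ TwistedQuotient.cohomology ι U (σ.comp ι) i :=
  (groupCohomology.functor R Γ i).mapIso (repIsoTwistedRep ι Δ τ U σ hστ hU)

/-- The comparison isomorphism on cohomology is the functoriality map of `repIsoTwistedRep`.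
[folklore] -/
theorem twistedCohomologyIso_hom (hστ : ∀ δ : Δ, τ δ = σ δ) (hU : U.toSubmonoid ≤ Δ) (i : ℕ) :
    (twistedCohomologyIso ι Δ τ U σ hστ hU i).hom =
      groupCohomology.map (MonoidHom.id Γ) (repIsoTwistedRep ι Δ τ U σ hστ hU).hom i :=
  rfl

/-- **The Hecke operators correspond on cohomology: `Φ_* ∘ [UαU] = T_α ∘ Φ_*`** for every
`α ∈ Δ` (`T_α = TwistedQuotient.heckeEnd ι U (σ ∘ ι) α i`). [cite: Hida1994AIF, §1]
[cite: KhareThorne2017, §6.4 Prop. 6.13] -/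
theorem heckeCohomology_comp_twistedCohomologyIso_hom (hστ : ∀ δ : Δ, τ δ = σ δ)
    (hU : U.toSubmonoid ≤ Δ) {α : 𝒢} (hα : α ∈ Δ) (i : ℕ) :
    (twistedCohomologyIso ι Δ τ U σ hστ hU i).hom.hom ∘ₗ heckeCohomology ι Δ τ U hU hα i =
      TwistedQuotient.heckeEnd ι U (σ.comp ι) α i ∘ₗ
        (twistedCohomologyIso ι Δ τ U σ hστ hU i).hom.hom := by
  rw [twistedCohomologyIso_hom]
  dsimp only [heckeCohomology, TwistedQuotient.heckeEnd, TwistedQuotient.heckeOperator]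
  rw [← ModuleCat.hom_comp, ← ModuleCat.hom_comp, ← groupCohomology.map_id_comp,
    ← groupCohomology.map_id_comp, heckeRepHom_comp_repIsoTwistedRep_hom ι hστ hU hα]

/-- Pointwise form: `Φ_* ([UαU] x) = T_α (Φ_* x)`. [folklore] -/
theorem twistedCohomologyIso_hom_heckeCohomology_apply (hστ : ∀ δ : Δ, τ δ = σ δ)
    (hU : U.toSubmonoid ≤ Δ) {α : 𝒢} (hα : α ∈ Δ) (i : ℕ) (x : cohomology ι Δ τ U i) :
    (twistedCohomologyIso ι Δ τ U σ hστ hU i).hom.hom (heckeCohomology ι Δ τ U hU hα i x) =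
      TwistedQuotient.heckeEnd ι U (σ.comp ι) α i
        ((twistedCohomologyIso ι Δ τ U σ hστ hU i).hom.hom x) :=
  LinearMap.congr_fun (heckeCohomology_comp_twistedCohomologyIso_hom ι hστ hU hα i) x

/-- The inverse direction: `Φ_*⁻¹ (T_α y) = [UαU] (Φ_*⁻¹ y)`. [folklore] -/
theorem twistedCohomologyIso_inv_heckeEnd_apply (hστ : ∀ δ : Δ, τ δ = σ δ)
    (hU : U.toSubmonoid ≤ Δ) {α : 𝒢} (hα : α ∈ Δ) (i : ℕ)
    (y : TwistedQuotient.cohomology ι U (σ.comp ι) i) :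
    (twistedCohomologyIso ι Δ τ U σ hστ hU i).inv.hom
        (TwistedQuotient.heckeEnd ι U (σ.comp ι) α i y) =
      heckeCohomology ι Δ τ U hU hα i ((twistedCohomologyIso ι Δ τ U σ hστ hU i).inv.hom y) := by
  set e := twistedCohomologyIso ι Δ τ U σ hστ hU i with he
  have hy : y = e.hom.hom (e.inv.hom y) := by
    rw [← ModuleCat.comp_apply, e.inv_hom_id, ModuleCat.id_apply]
  conv_lhs => rw [hy, ← twistedCohomologyIso_hom_heckeCohomology_apply ι hστ hU hα i]
  rw [he, ← ModuleCat.comp_apply, e.hom_inv_id, ModuleCat.id_apply]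

/-- The comparison isomorphism, as a linear equivalence `H^i(U, σ|_Δ) ≃ₗ H^i(X_U, Ṽ)`. [folklore] -/
def twistedCohomologyEquiv (hστ : ∀ δ : Δ, τ δ = σ δ) (hU : U.toSubmonoid ≤ Δ) (i : ℕ) :
    cohomology ι Δ τ U i ≃ₗ[R] TwistedQuotient.cohomology ι U (σ.comp ι) i :=
  (twistedCohomologyIso ι Δ τ U σ hστ hU i).toLinearEquiv

/-- Unfolding lemma for `twistedCohomologyEquiv`. [folklore] -/
@[simp]
theorem twistedCohomologyEquiv_apply (hστ : ∀ δ : Δ, τ δ = σ δ) (hU : U.toSubmonoid ≤ Δ) (i : ℕ)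
    (x : cohomology ι Δ τ U i) :
    twistedCohomologyEquiv ι hστ hU i x = (twistedCohomologyIso ι Δ τ U σ hστ hU i).hom.hom x :=
  rfl

/-- **Eigenvectors go to eigenvectors with the same eigenvalue**: if `[UαU] x = a • x` in
`H^i(U, σ|_Δ)` then `T_α (Φ_* x) = a • Φ_* x` in `H^i(X_U, Ṽ)`. [cite: KhareThorne2017, §6.5 Lemma 6.17] -/
theorem twistedCohomologyIso_eigenvector (hστ : ∀ δ : Δ, τ δ = σ δ) (hU : U.toSubmonoid ≤ Δ)
    {α : 𝒢} (hα : α ∈ Δ) (i : ℕ) {x : cohomology ι Δ τ U i} {a : R}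
    (hx : heckeCohomology ι Δ τ U hU hα i x = a • x) :
    TwistedQuotient.heckeEnd ι U (σ.comp ι) α i ((twistedCohomologyIso ι Δ τ U σ hστ hU i).hom.hom x) =
      a • (twistedCohomologyIso ι Δ τ U σ hστ hU i).hom.hom x := by
  rw [← twistedCohomologyIso_hom_heckeCohomology_apply ι hστ hU hα i, hx, map_smul]

/-- `Φ_* x ≠ 0 ↔ x ≠ 0` (an isomorphism). [folklore] -/
theorem twistedCohomologyIso_hom_apply_ne_zero_iff (hστ : ∀ δ : Δ, τ δ = σ δ)
    (hU : U.toSubmonoid ≤ Δ) (i : ℕ) (x : cohomology ι Δ τ U i) :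
    (twistedCohomologyIso ι Δ τ U σ hστ hU i).hom.hom x ≠ 0 ↔ x ≠ 0 :=
  (twistedCohomologyEquiv ι hστ hU i).map_ne_zero_iff

/-- **A simultaneous Hecke eigenclass of the coefficients-at-`p` model gives a non-zero simultaneous
eigenclass, with the same eigenvalues, in `H^i(X_U, Ṽ)`** (for any family of Hecke elements in `Δ`).
[cite: KhareThorne2017, §6.5 Lemma 6.17] -/
theorem exists_twisted_eigenclass (hστ : ∀ δ : Δ, τ δ = σ δ) (hU : U.toSubmonoid ≤ Δ) (i : ℕ)
    {J : Type*} (g : J → 𝒢) (hg : ∀ j, g j ∈ Δ) (a : J → R) {x : cohomology ι Δ τ U i}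
    (hx0 : x ≠ 0) (hx : ∀ j, heckeCohomology ι Δ τ U hU (hg j) i x = a j • x) :
    ∃ y : TwistedQuotient.cohomology ι U (σ.comp ι) i, y ≠ 0 ∧
      ∀ j, TwistedQuotient.heckeEnd ι U (σ.comp ι) (g j) i y = a j • y :=
  ⟨(twistedCohomologyIso ι Δ τ U σ hστ hU i).hom.hom x,
    (twistedCohomologyIso_hom_apply_ne_zero_iff ι hστ hU i x).2 hx0,
    fun j => twistedCohomologyIso_eigenvector ι hστ hU (hg j) i (hx j)⟩

end Literature.NumberTheory.Automorphic.LevelAction
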